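import Summits.Ventures.HodgeRepro0.P5BlockCensusDecomp

/-!
# P5BlockCensusCount — the allowed pieces of a block counted GENERICALLY: `2^|H| + 2`, hence the balanced subsets number
`(2^|H| + 2)^{#blocks}` for every instance, with no `2^{|block|}`-subset `decide`

p5 (g21), 2026-08-29.  Supporting artefact (R-5): finite combinatorics only; nothing here is an algebraicity statement.
Companion of `P5BlockCensusDecomp.lean`: under `Facts2`, the allowed pieces of the block of `crep i` are the unions of its
`|H|` conjugate pairs (in bijection with the subsets of the coset `cH`) together with the two cosets `cH` and `−cH`
(`allowed_card_eq`), so `card_balanced` becomes `(balancedSets D).card = ∏_i (2^{|cH|} + 2)` (`card_balanced_eq`) — the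
counts `258` of the `k`-Weil eightfolds, `66564` of `Y₁` and `65538` of the `k`-Weil sixteenfolds follow in the instance
file `P5BlockCensusCounts.lean` without the kernel enumeration of `2¹⁶` or `2³²` subsets.
-/

namespace HodgeRepro0.P5BlockCensus

variable {D : Data}

section
variable (hF : Facts D) (hG : Facts2 D)
include hF hG

omit hF in
/-- The pieces of the block that are unions of conjugate pairs correspond to the subsets of the coset. -/
theorem pairs_pieces_card (i : Fin D.creps.length) :
    ((block D (crep D i)).powerset.filter (fun P => PairsOn D P (crep D i))).card =
      2 ^ (coset D (crep D i)).toFinset.card := by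
  rw [← Finset.card_powerset]
  apply Finset.card_nbij' (fun P => P ∩ (coset D (crep D i)).toFinset)
    (fun Q => Q ∪ Q.image (conj D))
  · intro P hP
    rw [Finset.mem_coe, Finset.mem_powerset]
    exact Finset.inter_subset_right
  · intro Q hQ
    rw [Finset.mem_coe, Finset.mem_powerset] at hQ
    rw [Finset.mem_coe, Finset.mem_filter, Finset.mem_powerset]
    constructor
    · intro x hx
      rw [Finset.mem_union, Finset.mem_image] at hx
      rcases hx with hx | ⟨t, ht, rfl⟩
      · exact (g_block_mem hG i x (List.mem_toFinset.mp (hQ hx))).1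
      · exact (g_block_mem hG i t (List.mem_toFinset.mp (hQ ht))).2
    · intro t ht
      have htU := g_coset_units hG _ (g_crep_mem hG i) t ht
      constructor
      · intro h
        rw [Finset.mem_union, Finset.mem_image]
        rw [Finset.mem_union, Finset.mem_image] at h
        rcases h with h | ⟨t', ht', htt⟩
        · exact Or.inr ⟨t, h, rfl⟩
        · exfalso
          have ht'c := List.mem_toFinset.mp (hQ ht')
          have : conj D t = t' := by rw [← htt]; exact g_conj_conj hG t' (g_coset_units hG _ (g_crep_mem hG i) t' ht'c)
          exact g_conj_not_mem hG _ (g_crep_mem hG i) t ht (this ▸ ht'c)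
      · intro h
        rw [Finset.mem_union, Finset.mem_image] at h
        rcases h with h | ⟨t', ht', htt⟩
        · exfalso
          exact g_conj_not_mem hG _ (g_crep_mem hG i) t ht (List.mem_toFinset.mp (hQ h))
        · have ht'U := g_coset_units hG _ (g_crep_mem hG i) t' (List.mem_toFinset.mp (hQ ht'))
          have : t = t' := by
            have h1 := congrArg (conj D) htt
            rw [g_conj_conj hG t' ht'U, g_conj_conj hG t htU] at h1
            exact h1.symm
          rw [Finset.mem_union]; left; rw [this]; exact ht'
  · intro P hP
    rw [Finset.mem_coe, Finset.mem_filter, Finset.mem_powerset] at hP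
    obtain ⟨hPb, hpairs⟩ := hP
    ext x
    rw [Finset.mem_union, Finset.mem_image]
    constructor
    · rintro (hx | ⟨t, ht, rfl⟩)
      · exact (Finset.mem_inter.mp hx).1
      · obtain ⟨htP, htc⟩ := Finset.mem_inter.mp ht
        exact (hpairs t (List.mem_toFinset.mp htc)).mp htP
    · intro hx
      rcases (mem_block i x).mp (hPb hx) with hxc | ⟨t, ht, rfl⟩
      · left; exact Finset.mem_inter.mpr ⟨hx, List.mem_toFinset.mpr hxc⟩
      · right
        refine ⟨t, Finset.mem_inter.mpr ⟨(hpairs t ht).mpr hx, List.mem_toFinset.mpr ht⟩, rfl⟩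
  · intro Q hQ
    rw [Finset.mem_coe, Finset.mem_powerset] at hQ
    ext x
    rw [Finset.mem_inter, Finset.mem_union, Finset.mem_image]
    constructor
    · rintro ⟨hx | ⟨t, ht, rfl⟩, hxc⟩
      · exact hx
      · exfalso
        exact g_conj_not_mem hG _ (g_crep_mem hG i) t (List.mem_toFinset.mp (hQ ht)) (List.mem_toFinset.mp hxc)
    · intro hx; exact ⟨Or.inl hx, hQ hx⟩

omit hF in
/-- The pieces of the block that are exactly the coset: one. -/
theorem coset_pieces_card (i : Fin D.creps.length) :
    ((block D (crep D i)).powerset.filter (fun P => CosetOn D P (crep D i))).card = 1 := by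
  rw [Finset.card_eq_one]
  refine ⟨(coset D (crep D i)).toFinset, ?_⟩
  ext P
  rw [Finset.mem_filter, Finset.mem_powerset, Finset.mem_singleton]
  constructor
  · rintro ⟨hPb, hc⟩
    ext x
    constructor
    · intro hx
      rcases (mem_block i x).mp (hPb hx) with hxc | ⟨t, ht, rfl⟩
      · exact List.mem_toFinset.mpr hxc
      · exact absurd hx (hc t ht).2
    · intro hx; exact (hc x (List.mem_toFinset.mp hx)).1
  · rintro rfl
    refine ⟨?_, ?_⟩
    · intro x hx; exact (g_block_mem hG i x (List.mem_toFinset.mp hx)).1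
    · intro t ht
      exact ⟨List.mem_toFinset.mpr ht, fun h => g_conj_not_mem hG _ (g_crep_mem hG i) t ht (List.mem_toFinset.mp h)⟩

omit hF in
/-- The pieces of the block that are exactly the conjugate coset: one. -/
theorem conj_coset_pieces_card (i : Fin D.creps.length) :
    ((block D (crep D i)).powerset.filter (fun P => ConjCosetOn D P (crep D i))).card = 1 := by
  rw [Finset.card_eq_one]
  refine ⟨((coset D (crep D i)).map (conj D)).toFinset, ?_⟩
  ext P
  rw [Finset.mem_filter, Finset.mem_powerset, Finset.mem_singleton]
  constructor
  · rintro ⟨hPb, hc⟩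
    ext x
    constructor
    · intro hx
      rcases (mem_block i x).mp (hPb hx) with hxc | ⟨t, ht, rfl⟩
      · exact absurd hx (hc x hxc).1
      · exact List.mem_toFinset.mpr (List.mem_map.mpr ⟨t, ht, rfl⟩)
    · intro hx
      rw [List.mem_toFinset, List.mem_map] at hx
      obtain ⟨t, ht, rfl⟩ := hx
      exact (hc t ht).2
  · rintro rfl
    refine ⟨?_, ?_⟩
    · intro x hx
      rw [List.mem_toFinset, List.mem_map] at hx
      obtain ⟨t, ht, rfl⟩ := hx
      exact (g_block_mem hG i t ht).2
    · intro t ht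
      refine ⟨?_, List.mem_toFinset.mpr (List.mem_map.mpr ⟨t, ht, rfl⟩)⟩
      intro h
      rw [List.mem_toFinset, List.mem_map] at h
      obtain ⟨t', ht', htt⟩ := h
      have ht'U := g_coset_units hG _ (g_crep_mem hG i) t' ht'
      have : conj D t = t' := by rw [← htt]; exact g_conj_conj hG t' ht'U
      exact g_conj_not_mem hG _ (g_crep_mem hG i) t ht (this ▸ ht')

omit hF in
/-- The three kinds of pieces are pairwise disjoint. -/
theorem pieces_kinds_disjoint (i : Fin D.creps.length) :
    Disjoint ((block D (crep D i)).powerset.filter (fun P => PairsOn D P (crep D i)))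
        ((block D (crep D i)).powerset.filter (fun P => CosetOn D P (crep D i) ∨ ConjCosetOn D P (crep D i))) ∧
    Disjoint ((block D (crep D i)).powerset.filter (fun P => CosetOn D P (crep D i)))
        ((block D (crep D i)).powerset.filter (fun P => ConjCosetOn D P (crep D i))) := by
  have hcc : crep D i ∈ coset D (crep D i) :=
    List.mem_toFinset.mp (g_coset_mem_self hG _ (g_conj_units hG _ (g_crep_mem hG i)).2)
  constructor
  · rw [Finset.disjoint_left]
    intro P hP hP'
    rw [Finset.mem_filter] at hP hP'
    have h1 := hP.2 _ hcc
    rcases hP'.2 with h | h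
    · exact (h _ hcc).2 (h1.mp (h _ hcc).1)
    · exact (h _ hcc).1 (h1.mpr (h _ hcc).2)
  · rw [Finset.disjoint_left]
    intro P hP hP'
    rw [Finset.mem_filter] at hP hP'
    exact (hP'.2 _ hcc).1 (hP.2 _ hcc).1

omit hF in
/-- THE ALLOWED PIECES OF A BLOCK NUMBER `2^{|cH|} + 2`. -/
theorem allowed_card_eq (i : Fin D.creps.length) :
    (allowed D (crep D i)).card = 2 ^ (coset D (crep D i)).toFinset.card + 2 := by
  unfold allowed
  rw [Finset.filter_or, Finset.card_union_of_disjoint (pieces_kinds_disjoint hG i).1,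
    Finset.filter_or, Finset.card_union_of_disjoint (pieces_kinds_disjoint hG i).2,
    pairs_pieces_card hG i, coset_pieces_card hG i, conj_coset_pieces_card hG i]

/-- THE COUNT, generically: the balanced subsets of `U` number `∏_i (2^{|c_i H|} + 2)`. -/
theorem card_balanced_eq :
    (balancedSets D).card = ∏ i : Fin D.creps.length, (2 ^ (coset D (crep D i)).toFinset.card + 2) := by
  rw [card_balanced hF hG]
  apply Finset.prod_congr rfl
  intro i _
  exact allowed_card_eq hG i

end

end HodgeRepro0.P5BlockCensus
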